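import Literature.AlgebraicGeometry.Frobenioids.EquivalenceThm34ivvOfThm34iii
import Literature.AlgebraicGeometry.Frobenioids.EquivalenceThm34iiiOfPreSteps
import HarnessLib

/-!
# Frobenioids I, Theorem 3.4 (iv) and (v) AS TYPED over bases of FSMFF-type in the author's revised sense

Mochizuki, *The geometry of Frobenioids I: the general theory*, Kyushu J. Math. **62** (2008)
293–400, Thm. 3.4 (iv) p. 62 l. 36 – p. 63 l. 4, (v) p. 63 ll. 22–37 [cite: MochizukiFrdI2008, Thm. 3.4 (iv) p.63];
hypothesis (d) "FSMFF-type" of "standard type" (Def. 3.1 (i) p. 56) read in the sense of the author's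
*Comments on "The geometry of Frobenioids I"* (January 2024), item (28) [cite: MochizukiFrdIComments2024, (28) p.3].

PROOF-ONLY file (seat abc-iut-w4-d088; GAP-LEDGER row G-L1d8-1 "printed generality residual of [FrdI] Thm. 3.4",
downstream half per abc-iut-L1-lead R97 (2); companion of `EquivalenceThm34ivvOfThm34iii.lean`). The typed
statements `PreFrobenioidData.Thm34iv` (preservation of `O^▷(−)`, `O^×(−)`, `Ψ^{ℕ≥1} = id`) and
`PreFrobenioidData.Thm34v` (base-identity endomorphisms, base-equivalent pairs, the `1`-unique `Ψ^Base` with its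
rigid `1`-commutative square) of abc-iut-L1-t3's `BaseCategoryTheoreticity.lean` HOLD at `ofFunctor` for EVERY pair
of Frobenioids over bases of FSMFF-type in the revised (2024) sense and every equivalence `Ψ` — by the
base-agnostic closers `FrdI.thm34iv_ofFunctor_of_thm34ii_thm34iii` / `FrdI.thm34v_ofFunctor_of_thm34iii` fed
with Thm. 3.4 (ii) and (iii) over such bases (abc-iut-L1-t11: `FrdI.thm34ii_ofFunctor_of_isOfFSMFFType2024`,
`FrdI.thm34iii_ofFunctor_of_isOfFSMFFType2024`, the latter over the (ii)-agnostic re-derivation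
`FrdI.OfPreSteps.*` of abc-iut-L1-t13's Thm. 3.4 (iii) chain). Since FSM-type ⇒ FSMFF-type (revised)
(`IsOfFSMType.isOfFSMFFType2024`), this subsumes the FSM-type closers of abc-iut-w4-d093 (`Thm34iv`) and of
`EquivalenceThm34ivvOfThm34iii.lean` (`Thm34v`). The 2008-worded named facts `FrdI.Thm34iv`, `FrdI.Thm34v` are
reduced to `FrdI.Thm34ii`, `FrdI.Thm34iii` in the companion file and are NOT asserted here; no statement of the
paper is strengthened; no new definition.
-/

namespace Literature.AlgebraicGeometry.Frobenioids

namespace FrdI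

open CategoryTheory PreFrobenioidData

universe w v v' u u'

variable {D₁ : Type u} [Category.{v} D₁] {Φ₁ : D₁ᵒᵖ ⥤ CommMonCat.{w}} {C₁ : Type u'} [Category.{v'} C₁]
  {D₂ : Type u} [Category.{v} D₂] {Φ₂ : D₂ᵒᵖ ⥤ CommMonCat.{w}} {C₂ : Type u'} [Category.{v'} C₂]
  {F₁ : C₁ ⥤ ElemFrobenioid Φ₁} {F₂ : C₂ ⥤ ElemFrobenioid Φ₂}

/-- **[FrdI] Thm. 3.4 (iv), preservation part AS TYPED, over bases of FSMFF-type in the revised (2024) sense**: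
for every pair of Frobenioids `C_i → F_{Φ_i}` over such bases and every equivalence `Ψ`, under (a) standard type,
(b) `HypB`, (c) Frobenius-slim bases, `Ψ` preserves `O^▷(−)`, `O^×(−)` and Frobenius degrees.
[cite: MochizukiFrdI2008, Thm. 3.4 (iv) p.63] [cite: MochizukiFrdIComments2024, (28) p.3] -/
theorem thm34iv_ofFunctor_of_isOfFSMFFType2024 (hF₁ : PreFrobenioid.IsFrobenioid F₁)
    (hF₂ : PreFrobenioid.IsFrobenioid F₂) (hD₁ : IsOfFSMFFType2024 D₁) (hD₂ : IsOfFSMFFType2024 D₂)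
    (Ψ : C₁ ≌ C₂) : (ofFunctor Φ₁ F₁).Thm34iv (ofFunctor Φ₂ F₂) Ψ :=
  thm34iv_ofFunctor_of_thm34ii_thm34iii hF₁ hF₂ Ψ (thm34ii_ofFunctor_of_isOfFSMFFType2024 hF₁ hF₂ hD₁ hD₂ Ψ)
    (thm34ii_ofFunctor_symm_of_isOfFSMFFType2024 hF₁ hF₂ hD₁ hD₂ Ψ)
    (thm34iii_ofFunctor_of_isOfFSMFFType2024 hF₁ hF₂ hD₁ hD₂ Ψ)
    (thm34iii_ofFunctor_symm_of_isOfFSMFFType2024 hF₁ hF₂ hD₁ hD₂ Ψ)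

/-- **[FrdI] Thm. 3.4 (v) AS TYPED, over bases of FSMFF-type in the revised (2024) sense**: for every pair of
Frobenioids over such bases and every `Ψ`, under (a), (b), (c) slim bases, `Ψ` preserves base-identity
endomorphisms and base-equivalent pairs, and there is a `1`-unique `Ψ^Base : D₁ → D₂` with the rigid
`1`-commutative square over `Base₁, Base₂`. [cite: MochizukiFrdI2008, Thm. 3.4 (v) p.63] [cite: MochizukiFrdIComments2024, (28) p.3] -/
theorem thm34v_ofFunctor_of_isOfFSMFFType2024 (hF₁ : PreFrobenioid.IsFrobenioid F₁)
    (hF₂ : PreFrobenioid.IsFrobenioid F₂) (hD₁ : IsOfFSMFFType2024 D₁) (hD₂ : IsOfFSMFFType2024 D₂)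
    (Ψ : C₁ ≌ C₂) : (ofFunctor Φ₁ F₁).Thm34v (ofFunctor Φ₂ F₂) Ψ :=
  thm34v_ofFunctor_of_thm34iii hF₁ hF₂ Ψ (thm34iii_ofFunctor_of_isOfFSMFFType2024 hF₁ hF₂ hD₁ hD₂ Ψ)
    (thm34iii_ofFunctor_symm_of_isOfFSMFFType2024 hF₁ hF₂ hD₁ hD₂ Ψ)

/-- The same (iv) read for `Ψ⁻¹` (the shape in which consumers state hypothesis (b) for "some quasi-inverse").
[cite: MochizukiFrdI2008, Thm. 3.4 (iv) p.63] -/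
theorem thm34iv_ofFunctor_symm_of_isOfFSMFFType2024 (hF₁ : PreFrobenioid.IsFrobenioid F₁)
    (hF₂ : PreFrobenioid.IsFrobenioid F₂) (hD₁ : IsOfFSMFFType2024 D₁) (hD₂ : IsOfFSMFFType2024 D₂)
    (Ψ : C₁ ≌ C₂) : (ofFunctor Φ₂ F₂).Thm34iv (ofFunctor Φ₁ F₁) Ψ.symm :=
  thm34iv_ofFunctor_of_isOfFSMFFType2024 hF₂ hF₁ hD₂ hD₁ Ψ.symm

/-- The same (v) read for `Ψ⁻¹`. [cite: MochizukiFrdI2008, Thm. 3.4 (v) p.63] -/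
theorem thm34v_ofFunctor_symm_of_isOfFSMFFType2024 (hF₁ : PreFrobenioid.IsFrobenioid F₁)
    (hF₂ : PreFrobenioid.IsFrobenioid F₂) (hD₁ : IsOfFSMFFType2024 D₁) (hD₂ : IsOfFSMFFType2024 D₂)
    (Ψ : C₁ ≌ C₂) : (ofFunctor Φ₂ F₂).Thm34v (ofFunctor Φ₁ F₁) Ψ.symm :=
  thm34v_ofFunctor_of_isOfFSMFFType2024 hF₂ hF₁ hD₂ hD₁ Ψ.symm

end FrdI

end Literature.AlgebraicGeometry.Frobenioids
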